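import Mathlib.Algebra.MvPolynomial.CommRing
import Mathlib.Algebra.MvPolynomial.Eval
import Mathlib.Algebra.MvPolynomial.Degrees
import Mathlib.FieldTheory.Finite.Basic
import Mathlib.Data.Fin.VecNotation
import Mathlib.Algebra.BigOperators.Ring.Finset
import Mathlib.Data.Fintype.Option
import HarnessLib

/-!
# FrobPlane — the two-form sector of the Frobenius structure law, for EVERY prime

`FrobStructureLaw` (decomp-qadv-lens-6 g8, node `Theses.CharDial`, law 2½) predicts that a Boolean
function of `𝔽_p`-degree `≤ p - 1` is a bounded junta glued to a function of ONE linear form.  Its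
"two full linear forms" sector reduces (block symmetry + periodicity) to the following statement
about the affine plane over `𝔽_p`, proved here for every prime `p` (the census CENSUS-I1.md §A′
gives the ten-line paper proof; p = 3, 5 were previously only exhaustive-search data):

`frobPlane`: if `G : (Fin 2 → ZMod p) → Bool` agrees with a polynomial `P` of total degree
`≤ p - 1`, then `G x = h (a * x 0 + b * x 1)` for some `a b : ZMod p` and `h : ZMod p → Bool`
— i.e. `G⁻¹(true)` is empty, everything, or a union of parallel lines.

Proof: (i) `Σ_x eval x Q = 0` whenever `Q.totalDegree ≤ 2p - 3` (some exponent is `< p - 1`,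
and `Σ_{t : ZMod p} t^i = 0` for `i < p - 1`); (ii) hence all moments `Σ_{G x} φ(x)^k`, `k ≤ p-2`,
of every linear functional vanish, so the fibre counts `N_φ(c) = #{x : G x ∧ φ x = c}` are all
congruent mod `p` (expand `1 - (φ - c)^{p-1}`); as `0 ≤ N_φ(c) ≤ p`, either they all lie in
`{0, p}` (then `G` factors through `φ`) or they are all EQUAL to some `0 < λ < p`; (iii) if the
latter held for all `p + 1` directions, counting `G⁻¹(true)` along the lines through a point
outside it gives `(p+1)λ = |E| = pλ`, absurd.
-/

namespace Summit.QuantumAdvantage.AdviceFreeQNC0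
namespace FrobPlane

open MvPolynomial Finset

variable {p : ℕ} [hp : Fact p.Prime]

/-! ## (i) low-degree polynomials sum to zero over the plane -/

/-- CharDial sub-characteristic helper `sum_prod_pow_eq_zero` (lens-6 g8 LAND package; see the module docstring). -/
theorem sum_prod_pow_eq_zero (d : Fin 2 → ℕ) (i : Fin 2) (hi : d i < p - 1) :
    ∑ x : Fin 2 → ZMod p, ∏ j, x j ^ d j = 0 := by
  have h := Finset.sum_prod_piFinset (univ : Finset (ZMod p)) (fun (j : Fin 2) (t : ZMod p) => t ^ d j)
  rw [Fintype.piFinset_univ] at h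
  rw [h]
  apply Finset.prod_eq_zero (Finset.mem_univ i)
  have := FiniteField.sum_pow_lt_card_sub_one (K := ZMod p) (d i) (by rwa [ZMod.card])
  simpa using this

/-- CharDial sub-characteristic helper `sum_eval_eq_zero` (lens-6 g8 LAND package; see the module docstring). -/
theorem sum_eval_eq_zero (Q : MvPolynomial (Fin 2) (ZMod p)) (hQ : Q.totalDegree ≤ 2 * p - 3) :
    ∑ x : Fin 2 → ZMod p, eval x Q = 0 := by
  have hp2 : 2 ≤ p := hp.out.two_le
  have key : ∀ d ∈ Q.support, ∑ x : Fin 2 → ZMod p, ∏ j, x j ^ d j = 0 := by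
    intro d hd
    have hle : (d.sum fun _ e => e) ≤ 2 * p - 3 := (le_totalDegree hd).trans hQ
    rw [Finsupp.sum_fintype _ _ (fun _ => rfl), Fin.sum_univ_two] at hle
    by_cases h0 : d 0 < p - 1
    · exact sum_prod_pow_eq_zero d 0 h0
    · exact sum_prod_pow_eq_zero d 1 (by omega)
  calc ∑ x : Fin 2 → ZMod p, eval x Q
      = ∑ x : Fin 2 → ZMod p, ∑ d ∈ Q.support, Q.coeff d * ∏ j, x j ^ d j :=
        Finset.sum_congr rfl fun x _ => eval_eq' x Q
    _ = ∑ d ∈ Q.support, Q.coeff d * ∑ x : Fin 2 → ZMod p, ∏ j, x j ^ d j := by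
        rw [Finset.sum_comm]; exact Finset.sum_congr rfl fun d _ => by rw [Finset.mul_sum]
    _ = 0 := Finset.sum_eq_zero fun d hd => by rw [key d hd, mul_zero]

/-! ## the p + 1 directions of the plane -/

/-- The linear functional of direction `o`: `none` ↦ `x 0` (vertical fibres), `some m` ↦ `x 1 - m * x 0`. -/
def lin (o : Option (ZMod p)) (x : Fin 2 → ZMod p) : ZMod p :=
  match o with
  | none => x 0
  | some m => x 1 - m * x 0

/-- The same functional as a polynomial. -/
noncomputable def linPoly (o : Option (ZMod p)) : MvPolynomial (Fin 2) (ZMod p) :=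
  match o with
  | none => X 0
  | some m => X 1 - C m * X 0

/-- CharDial sub-characteristic helper `eval_linPoly` (lens-6 g8 LAND package; see the module docstring). -/
theorem eval_linPoly (o : Option (ZMod p)) (x : Fin 2 → ZMod p) : eval x (linPoly o) = lin o x := by
  cases o <;> simp [linPoly, lin]

/-- CharDial sub-characteristic helper `totalDegree_linPoly` (lens-6 g8 LAND package; see the module docstring). -/
theorem totalDegree_linPoly (o : Option (ZMod p)) : (linPoly o).totalDegree ≤ 1 := by
  cases o with
  | none => simp [linPoly, totalDegree_X]
  | some m =>
    simp only [linPoly]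
    refine (totalDegree_sub _ _).trans (max_le ?_ ?_)
    · simp [totalDegree_X]
    · refine (totalDegree_mul _ _).trans ?_
      simp [totalDegree_C, totalDegree_X]

/-- Parametrisation of the fibre `lin o ⁻¹ c` by `ZMod p`. -/
def fibPt (o : Option (ZMod p)) (c t : ZMod p) : Fin 2 → ZMod p :=
  match o with
  | none => ![c, t]
  | some m => ![t, c + m * t]

/-- CharDial sub-characteristic helper `lin_fibPt` (lens-6 g8 LAND package; see the module docstring). -/
theorem lin_fibPt (o : Option (ZMod p)) (c t : ZMod p) : lin o (fibPt o c t) = c := by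
  cases o <;> simp [lin, fibPt]

/-- CharDial sub-characteristic helper `fibPt_injective` (lens-6 g8 LAND package; see the module docstring). -/
theorem fibPt_injective (o : Option (ZMod p)) (c : ZMod p) : Function.Injective (fibPt o c) := by
  intro t t' h
  cases o with
  | none => have := congrFun h 1; simpa [fibPt] using this
  | some m => have := congrFun h 0; simpa [fibPt] using this

/-- CharDial sub-characteristic helper `eq_fibPt` (lens-6 g8 LAND package; see the module docstring). -/
theorem eq_fibPt (o : Option (ZMod p)) (x : Fin 2 → ZMod p) :
    ∃ t, fibPt o (lin o x) t = x := by
  cases o with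
  | none => refine ⟨x 1, ?_⟩; funext i; fin_cases i <;> simp [fibPt, lin]
  | some m => refine ⟨x 0, ?_⟩; funext i; fin_cases i <;> simp [fibPt, lin]

/-- Every fibre of every direction has exactly `p` points. -/
theorem card_fibre (o : Option (ZMod p)) (c : ZMod p) :
    (univ.filter fun x : Fin 2 → ZMod p => lin o x = c).card = p := by
  have : (univ.filter fun x : Fin 2 → ZMod p => lin o x = c) = univ.image (fibPt o c) := by
    ext x
    simp only [mem_filter, mem_univ, true_and, mem_image]
    constructor
    · intro hx; obtain ⟨t, ht⟩ := eq_fibPt o x; exact ⟨t, by rw [← hx]; exact ht⟩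
    · rintro ⟨t, rfl⟩; exact lin_fibPt o c t
  rw [this, card_image_of_injective _ (fibPt_injective o c), card_univ, ZMod.card]

/-! ## (ii) moments and fibre counts of a low-degree Boolean function -/

section Setting

variable (G : (Fin 2 → ZMod p) → Bool) (P : MvPolynomial (Fin 2) (ZMod p))

/-- the indicator of `G` as a `ZMod p`-valued function -/
def ind (x : Fin 2 → ZMod p) : ZMod p := if G x then 1 else 0

/-- the set `E = G⁻¹(true)` -/
def supp : Finset (Fin 2 → ZMod p) := univ.filter fun x => G x = true

/-- fibre counts `N_o(c) = #{x : G x ∧ lin o x = c}` -/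
def cnt (o : Option (ZMod p)) (c : ZMod p) : ℕ :=
  (univ.filter fun x : Fin 2 → ZMod p => G x = true ∧ lin o x = c).card

/-- CharDial sub-characteristic helper `cnt_le` (lens-6 g8 LAND package; see the module docstring). -/
theorem cnt_le (o : Option (ZMod p)) (c : ZMod p) : cnt G o c ≤ p := by
  unfold cnt
  calc (univ.filter fun x : Fin 2 → ZMod p => G x = true ∧ lin o x = c).card
      ≤ (univ.filter fun x : Fin 2 → ZMod p => lin o x = c).card :=
        card_le_card fun x hx => by simp only [mem_filter, mem_univ, true_and] at hx ⊢; exact hx.2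
    _ = p := card_fibre o c

/-- CharDial sub-characteristic helper `card_supp_eq_sum_cnt` (lens-6 g8 LAND package; see the module docstring). -/
theorem card_supp_eq_sum_cnt (o : Option (ZMod p)) : (supp G).card = ∑ c : ZMod p, cnt G o c := by
  unfold supp cnt
  rw [card_eq_sum_card_fiberwise (f := lin o) (t := univ) (fun x _ => by simp)]
  refine Finset.sum_congr rfl fun c _ => ?_
  congr 1; ext x; simp [Finset.mem_filter]

variable (hdeg : P.totalDegree ≤ p - 1) (hP : ∀ x, eval x P = ind G x)
include hdeg hP

/-- moments of order `k ≤ p - 2` vanish -/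
theorem moment_eq_zero (o : Option (ZMod p)) (k : ℕ) (hk : k ≤ p - 2) :
    ∑ x : Fin 2 → ZMod p, ind G x * lin o x ^ k = 0 := by
  have hp2 : 2 ≤ p := hp.out.two_le
  have h1 : ∀ x : Fin 2 → ZMod p, ind G x * lin o x ^ k = eval x (P * linPoly o ^ k) := by
    intro x; rw [eval_mul, eval_pow, eval_linPoly, hP]
  rw [Finset.sum_congr rfl fun x _ => h1 x]
  apply sum_eval_eq_zero
  refine (totalDegree_mul _ _).trans ?_
  have h2 : (linPoly o ^ k).totalDegree ≤ k := by
    refine (totalDegree_pow _ _).trans ?_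
    have := totalDegree_linPoly o
    calc k * (linPoly o).totalDegree ≤ k * 1 := Nat.mul_le_mul_left k this
      _ = k := by simp
  omega

omit hdeg hP in
/-- the fibre counts, cast to `ZMod p`, as a polynomial sum -/
theorem cast_cnt (o : Option (ZMod p)) (c : ZMod p) :
    ((cnt G o c : ℕ) : ZMod p) = ∑ x : Fin 2 → ZMod p, ind G x * (1 - (lin o x - c) ^ (p - 1)) := by
  have hp1 : p - 1 ≠ 0 := by have := hp.out.two_le; omega
  unfold cnt
  rw [card_filter]
  push_cast
  refine Finset.sum_congr rfl fun x _ => ?_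
  unfold ind
  by_cases hG : G x = true
  · by_cases hc : lin o x = c
    · simp [hG, hc, zero_pow hp1]
    · have hne : lin o x - c ≠ 0 := sub_ne_zero.mpr hc
      simp [hG, hc, ZMod.pow_card_sub_one_eq_one hne]
  · simp [hG]

/-- KEY: all fibre counts of one direction are congruent mod `p` (to the count at `c = 0`). -/
theorem cast_cnt_eq (o : Option (ZMod p)) (c : ZMod p) :
    ((cnt G o c : ℕ) : ZMod p) = ((cnt G o 0 : ℕ) : ZMod p) := by
  have hp2 : 2 ≤ p := hp.out.two_le
  -- Σ ind * (lin - c)^(p-1) = Σ ind * lin^(p-1)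
  have hexp : ∀ c' : ZMod p, ∑ x : Fin 2 → ZMod p, ind G x * (lin o x - c') ^ (p - 1)
      = ∑ x : Fin 2 → ZMod p, ind G x * lin o x ^ (p - 1) := by
    intro c'
    have hbin : ∀ x : Fin 2 → ZMod p, (lin o x - c') ^ (p - 1)
        = (∑ k ∈ range (p - 1), lin o x ^ k * (-c') ^ (p - 1 - k) * ((p - 1).choose k : ZMod p))
          + lin o x ^ (p - 1) := by
      intro x
      rw [sub_eq_add_neg, add_pow, Finset.sum_range_succ]
      congr 1
      simp
    simp_rw [hbin, mul_add, Finset.sum_add_distrib, Finset.mul_sum]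
    rw [Finset.sum_comm]
    have hz : ∀ k ∈ range (p - 1),
        ∑ x : Fin 2 → ZMod p, ind G x * (lin o x ^ k * (-c') ^ (p - 1 - k) * ((p - 1).choose k : ZMod p)) = 0 := by
      intro k hk
      have hk' : k ≤ p - 2 := by have := Finset.mem_range.mp hk; omega
      have : ∑ x : Fin 2 → ZMod p, ind G x * (lin o x ^ k * (-c') ^ (p - 1 - k) * ((p - 1).choose k : ZMod p))
          = ((-c') ^ (p - 1 - k) * ((p - 1).choose k : ZMod p)) * ∑ x : Fin 2 → ZMod p, ind G x * lin o x ^ k := by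
        rw [Finset.mul_sum]; exact Finset.sum_congr rfl fun x _ => by ring
      rw [this, moment_eq_zero G P hdeg hP o k hk', mul_zero]
    rw [Finset.sum_eq_zero hz, zero_add]
  rw [cast_cnt G, cast_cnt G]
  simp_rw [mul_sub, Finset.sum_sub_distrib]
  rw [hexp c, hexp 0]

/-- Dichotomy per direction, branch 1: if one count is `≡ 0 (mod p)`, every count is `0` or `p`. -/
theorem cnt_zero_or_eq (o : Option (ZMod p)) (h0 : ((cnt G o 0 : ℕ) : ZMod p) = 0) (c : ZMod p) :
    cnt G o c = 0 ∨ cnt G o c = p := by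
  have hc : ((cnt G o c : ℕ) : ZMod p) = 0 := by rw [cast_cnt_eq G P hdeg hP o c, h0]
  rw [ZMod.natCast_eq_zero_iff] at hc
  have hle := cnt_le G o c
  obtain ⟨k, hk⟩ := hc
  have hp0 : 0 < p := hp.out.pos
  rcases Nat.lt_or_ge k 2 with hk2 | hk2
  · interval_cases k <;> simp_all
  · nlinarith

/-- Dichotomy per direction, branch 2: otherwise every count EQUALS the count at `0`. -/
theorem cnt_eq_of_ne (o : Option (ZMod p)) (h0 : ((cnt G o 0 : ℕ) : ZMod p) ≠ 0) (c : ZMod p) :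
    cnt G o c = cnt G o 0 := by
  have hc := cast_cnt_eq G P hdeg hP o c
  rw [ZMod.natCast_eq_natCast_iff'] at hc
  have hlec := cnt_le G o c
  have hle0 := cnt_le G o 0
  have hne0 : cnt G o 0 ≠ 0 := by rintro h; rw [h] at h0; simp at h0
  have hnep : cnt G o 0 ≠ p := by rintro h; rw [h] at h0; simp at h0
  have hlt0 : cnt G o 0 < p := lt_of_le_of_ne hle0 hnep
  rw [Nat.mod_eq_of_lt hlt0] at hc
  rcases Nat.lt_or_ge (cnt G o c) p with hlt | hge
  · rwa [Nat.mod_eq_of_lt hlt] at hc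
  · have : cnt G o c = p := le_antisymm hlec hge
    rw [this, Nat.mod_self] at hc
    exact absurd hc.symm hne0

/-- Branch 1 conclusion: `G` factors through the functional `lin o`. -/
theorem factors_of_zero (o : Option (ZMod p)) (h0 : ((cnt G o 0 : ℕ) : ZMod p) = 0) :
    ∀ x, G x = decide (cnt G o (lin o x) = p) := by
  intro x
  have hp0 : 0 < p := hp.out.pos
  rcases cnt_zero_or_eq G P hdeg hP o h0 (lin o x) with h | h
  · -- count 0: no true point on the fibre of x
    have hx : G x = false := by
      by_contra hG
      have hmem : x ∈ (univ.filter fun y : Fin 2 → ZMod p => G y = true ∧ lin o y = lin o x) :=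
        Finset.mem_filter.mpr ⟨Finset.mem_univ _, by simpa using hG, rfl⟩
      have : 0 < cnt G o (lin o x) := by unfold cnt; exact card_pos.mpr ⟨x, hmem⟩
      omega
    rw [hx, h]; simp; omega
  · -- count p: the whole fibre is true
    have hx : G x = true := by
      by_contra hG
      have hsub : (univ.filter fun y : Fin 2 → ZMod p => G y = true ∧ lin o y = lin o x)
          ⊂ (univ.filter fun y : Fin 2 → ZMod p => lin o y = lin o x) := by
        rw [Finset.ssubset_iff_of_subset (fun y hy => by
          simp only [mem_filter, mem_univ, true_and] at hy ⊢; exact hy.2)]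
        exact ⟨x, by simp, by simp [hG]⟩
      have := card_lt_card hsub
      rw [card_fibre] at this
      unfold cnt at h; omega
    rw [hx, h]; simp

/-! ## (iii) the lines through a point outside `E` -/

/-- direction of `y` seen from `x₀` -/
def dir (x₀ y : Fin 2 → ZMod p) : Option (ZMod p) :=
  if y 0 = x₀ 0 then none else some ((y 1 - x₀ 1) / (y 0 - x₀ 0))

omit hdeg hP in
/-- CharDial sub-characteristic helper `dir_eq_iff` (lens-6 g8 LAND package; see the module docstring). -/
theorem dir_eq_iff (x₀ y : Fin 2 → ZMod p) (hy : y ≠ x₀) (o : Option (ZMod p)) :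
    dir x₀ y = o ↔ lin o y = lin o x₀ := by
  have key : y 0 = x₀ 0 → y 1 ≠ x₀ 1 := by
    intro h0 h1; apply hy; funext i; fin_cases i <;> simp [h0, h1]
  cases o with
  | none =>
    unfold dir; simp only [lin]
    by_cases h0 : y 0 = x₀ 0 <;> simp [h0]
  | some m =>
    unfold dir; simp only [lin]
    by_cases h0 : y 0 = x₀ 0
    · simp only [h0, if_true, reduceCtorEq, false_iff]
      intro h; exact key h0 (by linear_combination h)
    · simp only [h0, if_false, Option.some.injEq]
      have hne : y 0 - x₀ 0 ≠ 0 := sub_ne_zero.mpr h0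
      rw [div_eq_iff hne]
      constructor
      · intro h; linear_combination h
      · intro h; linear_combination h

omit hdeg hP in
/-- Counting `E` along the `p + 1` lines through a point `x₀ ∉ E`. -/
theorem card_supp_eq_sum_dir (x₀ : Fin 2 → ZMod p) (hx₀ : G x₀ = false) :
    (supp G).card = ∑ o : Option (ZMod p), cnt G o (lin o x₀) := by
  unfold supp
  rw [card_eq_sum_card_fiberwise (f := dir x₀) (t := univ) (fun x _ => by simp)]
  refine Finset.sum_congr rfl fun o _ => ?_
  unfold cnt
  congr 1; ext y
  simp only [mem_filter, mem_univ, true_and]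
  constructor
  · rintro ⟨hG, hd⟩
    have hy : y ≠ x₀ := by rintro rfl; rw [hx₀] at hG; exact Bool.false_ne_true hG
    exact ⟨hG, (dir_eq_iff x₀ y hy o).mp hd⟩
  · rintro ⟨hG, hl⟩
    have hy : y ≠ x₀ := by rintro rfl; rw [hx₀] at hG; exact Bool.false_ne_true hG
    exact ⟨hG, (dir_eq_iff x₀ y hy o).mpr hl⟩

/-! ## the theorem -/

/-- CharDial sub-characteristic helper `factors` (lens-6 g8 LAND package; see the module docstring). -/
theorem factors : ∃ (o : Option (ZMod p)) (h : ZMod p → Bool), ∀ x, G x = h (lin o x) := by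
  have hp0 : 0 < p := hp.out.pos
  by_cases hex : ∃ o : Option (ZMod p), ((cnt G o 0 : ℕ) : ZMod p) = 0
  · obtain ⟨o, ho⟩ := hex
    exact ⟨o, fun c => decide (cnt G o c = p), factors_of_zero G P hdeg hP o ho⟩
  · exfalso
    push Not at hex
    -- every direction: all counts equal λ_o := cnt o 0, and |E| = p · λ_o
    have hE : ∀ o : Option (ZMod p), (supp G).card = p * cnt G o 0 := by
      intro o
      rw [card_supp_eq_sum_cnt G o, Finset.sum_congr rfl fun c _ => cnt_eq_of_ne G P hdeg hP o (hex o) c]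
      simp [Finset.sum_const, ZMod.card]
    have hlam : ∀ o : Option (ZMod p), cnt G o 0 = cnt G none 0 := by
      intro o; have := hE o; rw [hE none] at this; exact (Nat.eq_of_mul_eq_mul_left hp0 this).symm
    have hne0 : cnt G none 0 ≠ 0 := by intro h; apply hex none; rw [h]; simp
    have hltp : cnt G none 0 < p := by
      refine lt_of_le_of_ne (cnt_le G none 0) ?_
      intro h; apply hex none; rw [h]; simp
    -- a point outside E
    have hx₀ : ∃ x₀ : Fin 2 → ZMod p, G x₀ = false := by
      by_contra hall
      push Not at hall
      have hfull : (supp G).card = p ^ 2 := by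
        unfold supp
        rw [Finset.filter_true_of_mem (fun x _ => by simpa using hall x), card_univ, Fintype.card_fun,
          ZMod.card, Fintype.card_fin]
      have := hE none
      rw [hfull, pow_two] at this
      have := Nat.eq_of_mul_eq_mul_left hp0 this
      omega
    obtain ⟨x₀, hx₀⟩ := hx₀
    have hsum := card_supp_eq_sum_dir G x₀ hx₀
    rw [Finset.sum_congr rfl fun o _ => (cnt_eq_of_ne G P hdeg hP o (hex o) (lin o x₀)).trans (hlam o)] at hsum
    simp only [Finset.sum_const, card_univ, Fintype.card_option, ZMod.card, smul_eq_mul] at hsum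
    rw [hE none] at hsum
    -- p * λ = (p + 1) * λ with λ ≠ 0
    have : cnt G none 0 = 0 := by nlinarith
    exact hne0 this

end Setting

/-- **The two-form sector of the Frobenius structure law, every prime.**  A Boolean function on the
affine plane `𝔽_p²` that is given by a polynomial of total degree `≤ p - 1` is a function of a single
linear form (so `G⁻¹(true)` is `∅`, the plane, or a union of parallel lines). -/
theorem frobPlane (p : ℕ) [Fact p.Prime] (G : (Fin 2 → ZMod p) → Bool)
    (P : MvPolynomial (Fin 2) (ZMod p)) (hdeg : P.totalDegree ≤ p - 1)
    (hP : ∀ x, MvPolynomial.eval x P = if G x then 1 else 0) :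
    ∃ (a b : ZMod p) (h : ZMod p → Bool), ∀ x, G x = h (a * x 0 + b * x 1) := by
  obtain ⟨o, h, hh⟩ := factors G P hdeg (fun x => by rw [hP]; rfl)
  cases o with
  | none => exact ⟨1, 0, h, fun x => by rw [hh]; simp [lin]⟩
  | some m => exact ⟨-m, 1, h, fun x => by rw [hh]; congr 1; simp [lin]; ring⟩

end FrobPlane
end Summit.QuantumAdvantage.AdviceFreeQNC0
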